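import Summits.QuantumFields.BalabanUV.T4Continuum.Support.NE7K1LinHomUpper
import Summits.QuantumFields.BalabanUV.T4Continuum.Support.NE7K1LinTwoRunMonotone

/-!
# NE7K1LinHomLipschitz — row NE7 (node U5), candidate route HOM, path H1L, cell K1-lin(s): THE `∂_s` (LIPSCHITZ) LETTER OF THE
# TWO-CUTOFF LINE AT `A = 0`, UNIFORM IN THE REFINEMENT FACTOR `L` (on boxes)

Lineage `b2b-balaban-t4-ne7-p2` (CRUX PROVER NE7 #2), generation 66; corollary of `NE7K1LinHomUpper.schurB_form_le_hom` (the L-uniform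
upper two-run constant `C(d) = 5·(5∕2)^d`) through `NE7K1LinSchurLineDerivRel.lineOpR_inv_sub_inv_rel` exactly as
`NE7K1LinTwoRunMonotone.twoCutoff_inv_lipschitz_of_gt` (there the squeeze constant was `K > L − 1` from
`NE7K1LinTwoRunFaces.schurB_form_le_sharp`):  **`twoCutoff_inv_lipschitz_hom`** — on `R′ = Π_μ[0, nLM_μ)`, for all `s, t ∈ [0,1]`,
every `g` and every `L ≥ 1`, `‖(G(s) − G(t))g‖² ≤ (t − s)²·((5·(5∕2)^d − 1)∕min(2,a))²·‖g‖²`.  Since `L` is arbitrary (`L ↦ L^m`: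
any number of RG steps between run A and the finer run B on the same box), the `∂_s` letter of the interpolating line is bounded
UNIFORMLY IN THE NUMBER OF STEPS — the multi-step content of the K1-lin(s) line at `U = 1`; the integrated letter
(`NE7K1LinTwoRunMonotone.twoCutoff_inv_sub_sq_le_uniform`, `1∕min(2,a)`) was already step-uniform.  [folklore].

HONEST FRAMING: Gaussian `A = 0`, finite boxes, finite real matrices, [folklore]; ONE interpolating line between two runs in `U = 1`
gauge; a NEEDS-CONSTANT improvement (`(L−1)∕γ₀ ↦ (C(d)−1)∕γ₀`, L-free), no letter ∕ tag ∕ size of NE7 moves; nothing printed asserted;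
no `sorry`.  FIXED FINITE T⁴, rung (B)+1; NE7 NOT PRINTED ∕ NOT PROVED; spine 0∕9; NOT infinite volume, NOT mass gap, NOT Clay.  HONEST
DEPENDENCY: continuum YM on T⁴ ⇐ BetaPertH ∧ nine spine estimates (0/9 proved); BetaPertH ⇐ (D1) ∧ (D4) ∧ CAP+tail; G-an2-4 gates
asym, D1 and NE2/3/4.
-/

noncomputable section

open Finset Matrix

namespace Summit.QuantumFields.BalabanUV.T4Continuum.NE7K1LinHomLipschitz

open Literature.MathematicalPhysics.QuantumFieldTheory.Balaban1983to89
open Literature.MathematicalPhysics.QuantumFieldTheory.Balaban1983to89.B4Reflection242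
open Literature.MathematicalPhysics.QuantumFieldTheory.Balaban1983to89.B4Lower18
open NE7K1LinSchurLineForm NE7K1LinBlockCoords NE7K1LinSchurLineU1 NE7K1LinTwoRunKit NE7K1LinTwoRunUpper
  NE7K1LinTwoRunLower NE7K1LinSchurLineDerivRel NE7K1LinSchurLineDerivU1 NE7K1LinTwoRunJensen NE7K1LinTwoRunFaces
  NE7K1LinInvAntitone NE7K1LinTwoRunMonotone NE7K1LinHomLift NE7K1LinHomUpper

variable {d n L : ℕ} [NeZero L]

/-- **THE LIPSCHITZ LETTER, UNIFORM IN THE REFINEMENT FACTOR**: on a box `R′ = Π_μ[0, nLM_μ)`, for all `s, t ∈ [0,1]`, every `g`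
and EVERY `L ≥ 1`, `‖(G(s) − G(t))g‖² ≤ (t−s)²·((5·(5∕2)^d − 1)∕min(2,a))²·‖g‖²` — the squeeze constant of
`NE7K1LinSchurLineDerivRel.lineOpR_inv_sub_inv_rel` is `K = C(d) − 1` with `C(d) = 5·(5∕2)^d` the L-uniform upper constant of
`NE7K1LinHomUpper.schurB_form_le_hom` (against `NE7K1LinTwoRunMonotone.twoCutoff_inv_lipschitz_sharp`'s `(L−1)∕min(2,a)`, which
grows with `L`): the `∂_s` letter of the two-cutoff line at `A = 0` is bounded UNIFORMLY IN THE NUMBER OF RG STEPS between the two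
runs (`L ↦ L^m`). [folklore] -/
theorem twoCutoff_inv_lipschitz_hom (hn : 1 ≤ n) (M : Fin (d + 1) → ℕ) {R' : Finset (Fin (d + 1) → ℤ)}
    (hbox : R' = boxDom fun μ => n * L * M μ) (hR' : IsBlockUnion (n * L) R') {a : ℝ} (ha : 0 < a)
    {s t : ℝ} (hs0 : 0 ≤ s) (hs1 : s ≤ 1) (ht0 : 0 ≤ t) (ht1 : t ≤ 1) (g : ↥(R'.image (blk L)) → ℝ) :
    ((twoCutoffLine (isBlockUnion_fine hR') n a s)⁻¹ - (twoCutoffLine (isBlockUnion_fine hR') n a t)⁻¹).mulVec g ⬝ᵥ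
        ((twoCutoffLine (isBlockUnion_fine hR') n a s)⁻¹ - (twoCutoffLine (isBlockUnion_fine hR') n a t)⁻¹).mulVec g ≤
      (t - s) ^ 2 * ((5 * (5 / 2 : ℝ) ^ d - 1) / min 2 a) ^ 2 * (g ⬝ᵥ g) := by
  have hL : 1 ≤ L := NeZero.one_le
  have hR'L : IsBlockUnion L R' := isBlockUnion_fine hR'
  have hRc : IsBlockUnion n (R'.image (blk L)) := isBlockUnion_coarse hL hR'
  have hmin : 0 < min 2 a := lt_min (by norm_num) ha
  have hC1 : (1 : ℝ) ≤ (5 / 2 : ℝ) ^ d := one_le_pow₀ (by norm_num)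
  have hKpos : (0 : ℝ) < 5 * (5 / 2 : ℝ) ^ d - 1 := by linarith
  set H := runB hR'L n a with hH
  have hP₀ : ∀ v, min 2 a * (v ⬝ᵥ v) ≤ v ⬝ᵥ (runA n L a R').mulVec v := fun v => lower18_zero hn ha.le hRc v
  have hP₀nn : ∀ v, 0 ≤ v ⬝ᵥ (runA n L a R').mulVec v := fun v =>
    le_trans (mul_nonneg hmin.le ((Finset.sum_nonneg fun i _ => mul_self_nonneg (v i)))) (hP₀ v)
  have hlow' : ∀ v, 1 * (v ⬝ᵥ (runA n L a R').mulVec v) ≤ v ⬝ᵥ (twoCutoffLine hR'L n a 1).mulVec v := fun v => by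
    rw [one_mul]; exact runA_form_le_schurB_sharp hn hR' ha v
  have hup' : ∀ v, v ⬝ᵥ (twoCutoffLine hR'L n a 1).mulVec v ≤ 5 * (5 / 2 : ℝ) ^ d * (v ⬝ᵥ (runA n L a R').mulVec v) :=
    fun v => schurB_form_le_hom hn M hbox hR' ha v
  simp only [twoCutoffLine_one] at hlow' hup'
  have hP₁ : ∀ v, min 2 a * (v ⬝ᵥ v) ≤
      v ⬝ᵥ (H.toBlocks₁₁ - H.toBlocks₁₂ * (H.toBlocks₂₂)⁻¹ * H.toBlocks₂₁).mulVec v := by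
    intro v
    have h1 := hlow' v
    rw [one_mul] at h1
    exact (hP₀ v).trans h1
  have hup : ∀ v, v ⬝ᵥ (H.toBlocks₁₁ - H.toBlocks₁₂ * (H.toBlocks₂₂)⁻¹ * H.toBlocks₂₁).mulVec v -
      v ⬝ᵥ (runA n L a R').mulVec v ≤ (5 * (5 / 2 : ℝ) ^ d - 1) * (v ⬝ᵥ (runA n L a R').mulVec v) := by
    intro v
    have h1 := hup' v
    linarith
  have hlo : ∀ v, v ⬝ᵥ (runA n L a R').mulVec v -
      v ⬝ᵥ (H.toBlocks₁₁ - H.toBlocks₁₂ * (H.toBlocks₂₂)⁻¹ * H.toBlocks₂₁).mulVec v ≤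
      (5 * (5 / 2 : ℝ) ^ d - 1) * (v ⬝ᵥ (runA n L a R').mulVec v) := by
    intro v
    have h1 := hlow' v; have h2 := hP₀nn v
    rw [one_mul] at h1
    nlinarith [mul_nonneg hKpos.le h2]
  have main := lineOpR_inv_sub_inv_rel (runA n L a R') H.toBlocks₁₁ H.toBlocks₁₂ H.toBlocks₂₁ H.toBlocks₂₂
    (fineOpR_isSymm n a 0 _) (schurB_isSymm hR'L n a) hmin one_pos le_rfl hKpos hP₀ hP₁ hlow' hup hlo hs0 hs1 ht0 ht1 g
  rw [one_mul] at main
  exact main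

/-- the line is below `5·(5∕2)^d·P_A` on `[0,1]`, on boxes, for every `L` (`NE7K1LinHomUpper.schurB_form_le_hom`; against
`NE7K1LinTwoRunMonotone.twoCutoffLine_form_le`'s `L·P_A`). [folklore] -/
theorem twoCutoffLine_form_le_hom (hn : 1 ≤ n) (M : Fin (d + 1) → ℕ) {R' : Finset (Fin (d + 1) → ℤ)}
    (hbox : R' = boxDom fun μ => n * L * M μ) (hR' : IsBlockUnion (n * L) R') {a : ℝ} (ha : 0 < a) {s : ℝ} (hs0 : 0 ≤ s)
    (hs1 : s ≤ 1) (v : ↥(R'.image (blk L)) → ℝ) :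
    v ⬝ᵥ (twoCutoffLine (isBlockUnion_fine hR') n a s).mulVec v ≤ 5 * (5 / 2 : ℝ) ^ d * (v ⬝ᵥ (runA n L a R').mulVec v) := by
  have h1 := schurB_form_le_hom hn M hbox hR' ha v
  have h0 : 0 ≤ v ⬝ᵥ (runA n L a R').mulVec v :=
    le_trans (mul_nonneg (lt_min (by norm_num) ha).le ((Finset.sum_nonneg fun i _ => mul_self_nonneg (v i))))
      (lower18_zero hn ha.le (isBlockUnion_coarse NeZero.one_le hR') v)
  have hC1 : (1 : ℝ) ≤ 5 * (5 / 2 : ℝ) ^ d := by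
    have : (1 : ℝ) ≤ (5 / 2 : ℝ) ^ d := one_le_pow₀ (by norm_num)
    linarith
  rw [twoCutoffLine_eq (isBlockUnion_fine hR') n a s]
  simp only [add_mulVec, smul_mulVec, dotProduct_add, dotProduct_smul, smul_eq_mul]
  nlinarith [mul_le_mul_of_nonneg_left h1 hs0, mul_nonneg (sub_nonneg.2 hs1) h0,
    mul_le_mul_of_nonneg_right hC1 h0]

end Summit.QuantumFields.BalabanUV.T4Continuum.NE7K1LinHomLipschitz
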